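import Summits.QuantumFields.YangMills.Theorems.VirialFluxGapResolventFieldStep
import Summits.QuantumFields.YangMills.Theorems.VirialFluxGapFixCurves
import Summits.QuantumFields.YangMills.Theorems.LuscherReductionRunningReductionAxialGaugeInner
import Summits.QuantumFields.YangMills.Theorems.LuscherReductionOneSiteLevelsMagnetic
import Summits.QuantumFields.YangMills.Theorems.LuscherReductionTwistedTraceScalingCombFlat
import HarnessLib

/-!
# Route `VirialFluxGap` (YangMills): the REGULARITY CUT-OFF `χ_reg` of the patching as a SMOOTH FUNCTION OF THE COORDINATES
# (item (a) of fcl-p3 g40's memo v3 §3 for ⟨stmt-QuantumFields-24141⟩ `VirialFluxGap.PeriodicSoftness`)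

The Euler field on the tree-gauged host `X_fix` is patched from the generic resolvent field (valid at `ρ`-REGULAR points: some regularity mass
`1 − Re²(su2Quat ·)` of the three slice-0 wrap representatives or of the seam root is `≥ ρ²`, ✓`FixFrame.exists_fixChart_of_regular`, fcl-p3's
✓`fix_generic_*`) and the central charts (valid at `ρ`-CENTRAL points: all four masses `< ρ²`, ✓`exists_fixCentralChart_of_central`; w3 lineage),
cf. ✓`FixFrame.regular_or_central`.  The last-mile reduction ✓`FixField.periodicSoftness_of_smoothFrameField_cutoff` wants the patched
coefficients as SMOOTH functions of the matrix coordinates; this file supplies the partition function: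

* §1 defs `wrapEdge k` (the wrap link of ✓`wrapReps`: `wrapReps U k = treeFix U (wrapEdge k)`), `linkMass k M := 1 − (Re tr(M.1 0 (wrapEdge k))/2)²`,
  `seamMass M := 1 − (Re tr(M.2 0)/2)²` and ★ `regCutoff ρ M := 1 − Π_k ψ(linkMass k M/ρ²) · ψ(seamMass M/ρ²)` with fcl-p3's smooth step ✓`deficitStep`
  (`ψ = 1` on `[0,½]`, `ψ = 0` on `[1,∞)`);
* §2 ON RING HISTORIES: `linkMass_ringCoord` ∕ `seamMass_ringCoord` (`= 1 − Re²(su2Quat ·)` of the raw link ∕ seam root), and on `X_fix` points (slice `0`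
  comb-gauged, ✓`treeFix_glue`) `linkMass_fixEmbed` — EXACTLY the masses of ✓`regular_or_central`;
* §3 ★★ THE PARTITION: `regCutoff_nonneg`, `regCutoff_le_one`, ★ `regCutoff_eq_one_of_regular` (some mass `≥ ρ²` ⇒ `χ_reg = 1`: the generic chart
  alone carries the field there), ★ `regCutoff_eq_zero_of_central` (all masses `≤ ρ²/2` ⇒ `χ_reg = 0`: the central chart alone) — the OVERLAP
  `{all masses < ρ², some mass > ρ²/2}` is `(ρ/√2)`-regular AND `ρ`-central, so both pointwise packages apply on `supp ∇χ_reg`;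
* §4 SMOOTHNESS: `contDiff_linkMass`, `contDiff_seamMass`, ★ `contDiff_regCutoff` (so `χ_reg·c¹ + (1 − χ_reg)·c²` keeps the coefficients smooth and
  ✓`fixUnitCurve_field_package` applies); frame-derivative LETTERS `frameD_mul`, `frameD_one_sub`, ★ `frameD_patch`
  (`∂_Y(χc¹ + (1−χ)c²) = χ∂_Yc¹ + (1−χ)∂_Yc² + ∂_Yχ·(c¹ − c²)`), `contDiff_patch`;
* the DERIVATIVES of the cut-off (explicit `∂_Y` of the masses, locality — only 12 frame directions see `χ_reg` — and the absolute bound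
  `|∂_Y χ_reg| ≤ C/ρ²`) are in the companion file `VirialFluxGapRegularityCutoffDerivative`.

HONEST FRAMING: plumbing (four problem-side data definitions `wrapEdge`, `linkMass`, `seamMass`, `regCutoff`; no `Prop`, no named fact); the
patching INEQUALITIES (drive ∕ divergence budgets with the cross term), the central charts and the assembly are NOT here; ⟨24141⟩ and ⟨22884⟩ stay OPEN;
no stub ∕ crux ∕ rung ∕ summit is closed; the Yang–Mills mass gap is NOT proved; no summit is proved by a line.  0 `sorry`, standard axioms.
Width seat `ym-line-sfw-p2-w2` g52 (cell ym-idea-1, free hands), `--supports stmt-QuantumFields-24141`.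
References: [cite: Luscher1983, §2] (torons, wrap representatives); [cite: SeilerLNP1982, §2] (tree gauge); [folklore] (partitions of unity).
-/

set_option autoImplicit false

noncomputable section

open scoped Matrix BigOperators ContDiff Topology Quaternion
open MeasureTheory
open Literature.MathematicalPhysics.QuantumFieldTheory hiding SU2
open Literature.MathematicalPhysics.QuantumLattice
open Literature.MathematicalPhysics.QuantumFieldTheory.SUNBakryEmery (expSU coe_expSU matTop)

namespace Summit.QuantumFields.YangMills.Theorems.VirialFluxGap.RegCutoff

open Summit.QuantumFields.YangMills.Theorems.FemtoTransferGap
open Summit.QuantumFields.YangMills.Theorems.FemtoTransferGap.TT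
open Summit.QuantumFields.YangMills.Theorems.FemtoTransferGap.TwoLattice
open Summit.QuantumFields.YangMills.Theorems.FemtoTransferGap.TwoLattice.Flat
open Summit.QuantumFields.YangMills.Theorems.VirialFluxGap.RingDeficit
open Summit.QuantumFields.YangMills.Theorems.VirialFluxGap.FrameDerivative
open Summit.QuantumFields.YangMills.Theorems.VirialFluxGap.FrameHessian

variable {L : ℕ} [NeZero L]

open scoped Matrix.Norms.Frobenius

attribute [local instance 2000] Literature.MathematicalPhysics.QuantumFieldTheory.SUNBakryEmery.matTop

/-! ## §1 The regularity masses and the cut-off as functions of the coordinates -/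

/-- The wrap link of direction `k` on the layer `x_k = −1` through the origin (the link of ✓`wrapReps`). [cite: SeilerLNP1982, §2] -/
def wrapEdge (k : Fin 3) : Edge 3 L := ![(mk3 (-1) 0 0, 0), (mk3 0 (-1) 0, 1), (mk3 0 0 (-1), 2)] k

omit [NeZero L] in
/-- `wrapReps U k` is the comb-gauge-fixed wrap link `treeFix U (wrapEdge k)`. [cite: Luscher1983, §2] -/
theorem wrapReps_eq (U : GaugeConfig 3 L SU2) (k : Fin 3) : wrapReps U k = treeFix U (wrapEdge k) := by
  fin_cases k <;> rfl

/-- The REGULARITY MASS of the slice-0 wrap link `k` as a function of the coordinates: `1 − (Re tr M.1 0 (wrapEdge k)/2)²`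
(`= 1 − Re²(su2Quat ·) = |Im su2Quat ·|²` on a ring history). [cite: Luscher1983, §2] -/
def linkMass (k : Fin 3) (M : (Fin (2 * L - 1 + 1) → Edge 3 L → Matrix (Fin 2) (Fin 2) ℂ) × (Site 3 L → Matrix (Fin 2) (Fin 2) ℂ)) : ℝ :=
  1 - (((M.1 0 (wrapEdge k)).trace).re / 2) ^ 2

/-- The REGULARITY MASS of the seam root as a function of the coordinates: `1 − (Re tr M.2 0/2)²`. [cite: Luscher1983, §2] -/
def seamMass (M : (Fin (2 * L - 1 + 1) → Edge 3 L → Matrix (Fin 2) (Fin 2) ℂ) × (Site 3 L → Matrix (Fin 2) (Fin 2) ℂ)) : ℝ :=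
  1 - (((M.2 0).trace).re / 2) ^ 2

/-- ★ The REGULARITY CUT-OFF `χ_reg(M) = 1 − ψ(m₀/ρ²)ψ(m₁/ρ²)ψ(m₂/ρ²)ψ(m_seam/ρ²)` with fcl-p3's smooth step `ψ = deficitStep`
(`= 1` on `[0,½]`, `= 0` on `[1,∞)`): `χ_reg = 1` as soon as ONE mass is `≥ ρ²` (regular), `χ_reg = 0` when ALL masses are `≤ ρ²/2` (central). [folklore] -/
def regCutoff (ρ : ℝ) (M : (Fin (2 * L - 1 + 1) → Edge 3 L → Matrix (Fin 2) (Fin 2) ℂ) × (Site 3 L → Matrix (Fin 2) (Fin 2) ℂ)) : ℝ :=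
  1 - (deficitStep (linkMass 0 M / ρ ^ 2) * deficitStep (linkMass 1 M / ρ ^ 2) * deficitStep (linkMass 2 M / ρ ^ 2)) *
    deficitStep (seamMass M / ρ ^ 2)

/-! ## §2 The masses on ring histories and on `X_fix` points -/

/-- On a ring history the link mass is `1 − Re²(su2Quat)` of the raw slice-0 wrap link. [cite: Luscher1983, §2] -/
theorem linkMass_ringCoord (k : Fin 3) (P : (Fin (2 * L - 1 + 1) → GaugeConfig 3 L SU2) × (Site 3 L → SU2)) :
    linkMass k (ringCoord L P) = 1 - (su2Quat (P.1 0 (wrapEdge k))).re ^ 2 := by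
  unfold linkMass ringCoord
  dsimp only
  rw [su2_trace_re_eq_quat]
  ring

/-- On a ring history the seam mass is `1 − Re²(su2Quat)` of the seam root `P.2 0`. [cite: Luscher1983, §2] -/
theorem seamMass_ringCoord (P : (Fin (2 * L - 1 + 1) → GaugeConfig 3 L SU2) × (Site 3 L → SU2)) :
    seamMass (ringCoord L P) = 1 - (su2Quat (P.2 0)).re ^ 2 := by
  unfold seamMass ringCoord
  dsimp only
  rw [su2_trace_re_eq_quat]
  ring

/-- ★ On an `X_fix` point (slice `0` comb-gauged: `glue`), the link mass IS the mass of the wrap representative of ✓`regular_or_central`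
(✓`treeFix_glue`). [cite: SeilerLNP1982, §2] -/
theorem linkMass_fixEmbed (k : Fin 3) (x : (OffIdx L → SU2) × ((Fin (2 * L - 1) → GaugeConfig 3 L SU2) × (Site 3 L → SU2))) :
    linkMass k (ringCoord L ((Fin.cons (glue x.1) x.2.1 : Fin (2 * L - 1 + 1) → GaugeConfig 3 L SU2), x.2.2)) =
      1 - (su2Quat (wrapReps ((Fin.cons (glue x.1) x.2.1 : Fin (2 * L - 1 + 1) → GaugeConfig 3 L SU2) 0) k)).re ^ 2 := by
  rw [linkMass_ringCoord, wrapReps_eq]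
  have h0 : (Fin.cons (glue x.1) x.2.1 : Fin (2 * L - 1 + 1) → GaugeConfig 3 L SU2) 0 = glue x.1 := Fin.cons_zero _ _
  show 1 - (su2Quat ((Fin.cons (glue x.1) x.2.1 : Fin (2 * L - 1 + 1) → GaugeConfig 3 L SU2) 0 (wrapEdge k))).re ^ 2 =
    1 - (su2Quat (treeFix ((Fin.cons (glue x.1) x.2.1 : Fin (2 * L - 1 + 1) → GaugeConfig 3 L SU2) 0) (wrapEdge k))).re ^ 2
  rw [h0, treeFix_glue]

/-- On an `X_fix` point the seam mass is the mass of the seam root of ✓`regular_or_central`. [folklore] -/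
theorem seamMass_fixEmbed (x : (OffIdx L → SU2) × ((Fin (2 * L - 1) → GaugeConfig 3 L SU2) × (Site 3 L → SU2))) :
    seamMass (ringCoord L ((Fin.cons (glue x.1) x.2.1 : Fin (2 * L - 1 + 1) → GaugeConfig 3 L SU2), x.2.2)) = 1 - (su2Quat (x.2.2 0)).re ^ 2 :=
  seamMass_ringCoord _

/-! ## §3 The partition: values in `[0,1]`, `= 1` on the regular region, `= 0` on the central core -/

omit [NeZero L] in
/-- A product of four numbers in `[0,1]` is in `[0,1]`. [folklore] -/
theorem prod4_mem_unit {a b c d : ℝ} (ha : 0 ≤ a) (ha1 : a ≤ 1) (hb : 0 ≤ b) (hb1 : b ≤ 1) (hc : 0 ≤ c) (hc1 : c ≤ 1) (hd : 0 ≤ d) (hd1 : d ≤ 1) :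
    0 ≤ a * b * c * d ∧ a * b * c * d ≤ 1 := by
  refine ⟨by positivity, ?_⟩
  calc a * b * c * d ≤ 1 * 1 * 1 * 1 := by gcongr
    _ = 1 := by ring

omit [NeZero L] in
/-- `0 ≤ χ_reg`. [folklore] -/
theorem regCutoff_nonneg (ρ : ℝ) (M : (Fin (2 * L - 1 + 1) → Edge 3 L → Matrix (Fin 2) (Fin 2) ℂ) × (Site 3 L → Matrix (Fin 2) (Fin 2) ℂ)) :
    0 ≤ regCutoff ρ M := by
  unfold regCutoff
  have h := prod4_mem_unit (deficitStep_nonneg (linkMass 0 M / ρ ^ 2)) (deficitStep_le_one _) (deficitStep_nonneg (linkMass 1 M / ρ ^ 2))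
    (deficitStep_le_one _) (deficitStep_nonneg (linkMass 2 M / ρ ^ 2)) (deficitStep_le_one _) (deficitStep_nonneg (seamMass M / ρ ^ 2))
    (deficitStep_le_one _)
  linarith [h.2]

omit [NeZero L] in
/-- `χ_reg ≤ 1`. [folklore] -/
theorem regCutoff_le_one (ρ : ℝ) (M : (Fin (2 * L - 1 + 1) → Edge 3 L → Matrix (Fin 2) (Fin 2) ℂ) × (Site 3 L → Matrix (Fin 2) (Fin 2) ℂ)) :
    regCutoff ρ M ≤ 1 := by
  unfold regCutoff
  have h := prod4_mem_unit (deficitStep_nonneg (linkMass 0 M / ρ ^ 2)) (deficitStep_le_one _) (deficitStep_nonneg (linkMass 1 M / ρ ^ 2))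
    (deficitStep_le_one _) (deficitStep_nonneg (linkMass 2 M / ρ ^ 2)) (deficitStep_le_one _) (deficitStep_nonneg (seamMass M / ρ ^ 2))
    (deficitStep_le_one _)
  linarith [h.1]

omit [NeZero L] in
/-- ★ **`χ_reg = 1` on the `ρ`-regular region**: if some regularity mass is `≥ ρ²`, the corresponding step factor vanishes. [folklore] -/
theorem regCutoff_eq_one_of_regular {ρ : ℝ} (hρ : 0 < ρ)
    {M : (Fin (2 * L - 1 + 1) → Edge 3 L → Matrix (Fin 2) (Fin 2) ℂ) × (Site 3 L → Matrix (Fin 2) (Fin 2) ℂ)}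
    (h : (∃ k : Fin 3, ρ ^ 2 ≤ linkMass k M) ∨ ρ ^ 2 ≤ seamMass M) : regCutoff ρ M = 1 := by
  have hρ2 : 0 < ρ ^ 2 := by positivity
  have hstep : ∀ {m : ℝ}, ρ ^ 2 ≤ m → deficitStep (m / ρ ^ 2) = 0 := fun {m} hm =>
    deficitStep_eq_zero (by rwa [le_div_iff₀ hρ2, one_mul])
  unfold regCutoff
  rcases h with ⟨k, hk⟩ | hs
  · have h3 : ∀ i : Fin 3, i = 0 ∨ i = 1 ∨ i = 2 := by decide
    rcases h3 k with rfl | rfl | rfl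
    · rw [hstep hk]; ring
    · rw [hstep hk]; ring
    · rw [hstep hk]; ring
  · rw [hstep hs]; ring

omit [NeZero L] in
/-- ★ **`χ_reg = 0` on the `(ρ/√2)`-central core**: if all four regularity masses are `≤ ρ²/2`, every step factor is `1`. [folklore] -/
theorem regCutoff_eq_zero_of_central {ρ : ℝ} (hρ : 0 < ρ)
    {M : (Fin (2 * L - 1 + 1) → Edge 3 L → Matrix (Fin 2) (Fin 2) ℂ) × (Site 3 L → Matrix (Fin 2) (Fin 2) ℂ)}
    (hk : ∀ k : Fin 3, linkMass k M ≤ ρ ^ 2 / 2) (hs : seamMass M ≤ ρ ^ 2 / 2) : regCutoff ρ M = 0 := by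
  have hρ2 : 0 < ρ ^ 2 := by positivity
  have hstep : ∀ {m : ℝ}, m ≤ ρ ^ 2 / 2 → deficitStep (m / ρ ^ 2) = 1 := fun {m} hm =>
    deficitStep_eq_one (by rw [div_le_iff₀ hρ2]; linarith)
  unfold regCutoff
  rw [hstep (hk 0), hstep (hk 1), hstep (hk 2), hstep hs]
  ring

/-- ★ The partition on `X_fix` in the letters of ✓`regular_or_central`: `χ_reg = 1` at a `ρ`-regular point. [folklore] -/
theorem regCutoff_fixEmbed_eq_one_of_regular {ρ : ℝ} (hρ : 0 < ρ)
    (x : (OffIdx L → SU2) × ((Fin (2 * L - 1) → GaugeConfig 3 L SU2) × (Site 3 L → SU2)))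
    (h : (∃ k : Fin 3, ρ ^ 2 ≤ 1 - (su2Quat (wrapReps ((Fin.cons (glue x.1) x.2.1 : Fin (2 * L - 1 + 1) → GaugeConfig 3 L SU2) 0) k)).re ^ 2) ∨
      ρ ^ 2 ≤ 1 - (su2Quat (x.2.2 0)).re ^ 2) :
    regCutoff ρ (ringCoord L ((Fin.cons (glue x.1) x.2.1 : Fin (2 * L - 1 + 1) → GaugeConfig 3 L SU2), x.2.2)) = 1 := by
  refine regCutoff_eq_one_of_regular hρ ?_
  rcases h with ⟨k, hk⟩ | hs
  · exact Or.inl ⟨k, by rwa [linkMass_fixEmbed]⟩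
  · exact Or.inr (by rwa [seamMass_fixEmbed])

/-- ★ The partition on `X_fix`: `χ_reg = 0` at a `(ρ/√2)`-central point. [folklore] -/
theorem regCutoff_fixEmbed_eq_zero_of_central {ρ : ℝ} (hρ : 0 < ρ)
    (x : (OffIdx L → SU2) × ((Fin (2 * L - 1) → GaugeConfig 3 L SU2) × (Site 3 L → SU2)))
    (hk : ∀ k : Fin 3, 1 - (su2Quat (wrapReps ((Fin.cons (glue x.1) x.2.1 : Fin (2 * L - 1 + 1) → GaugeConfig 3 L SU2) 0) k)).re ^ 2 ≤ ρ ^ 2 / 2)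
    (hs : 1 - (su2Quat (x.2.2 0)).re ^ 2 ≤ ρ ^ 2 / 2) :
    regCutoff ρ (ringCoord L ((Fin.cons (glue x.1) x.2.1 : Fin (2 * L - 1 + 1) → GaugeConfig 3 L SU2), x.2.2)) = 0 :=
  regCutoff_eq_zero_of_central hρ (fun k => by rw [linkMass_fixEmbed]; exact hk k) (by rw [seamMass_fixEmbed]; exact hs)

omit [NeZero L] in
/-- On the support of `1 − χ_reg` every mass is `< ρ²` (the point is `ρ`-central); contrapositive of `regCutoff_eq_one_of_regular`. [folklore] -/
theorem central_of_regCutoff_ne_one {ρ : ℝ} (hρ : 0 < ρ)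
    {M : (Fin (2 * L - 1 + 1) → Edge 3 L → Matrix (Fin 2) (Fin 2) ℂ) × (Site 3 L → Matrix (Fin 2) (Fin 2) ℂ)} (h : regCutoff ρ M ≠ 1) :
    (∀ k : Fin 3, linkMass k M < ρ ^ 2) ∧ seamMass M < ρ ^ 2 := by
  by_contra hcon
  apply h
  refine regCutoff_eq_one_of_regular hρ ?_
  by_cases hs : ρ ^ 2 ≤ seamMass M
  · exact Or.inr hs
  · left
    by_contra hk
    push Not at hk
    exact hcon ⟨hk, lt_of_not_ge hs⟩

omit [NeZero L] in
/-- On the support of `χ_reg` some mass is `> ρ²/2` (the point is `(ρ/√2)`-regular); contrapositive of `regCutoff_eq_zero_of_central`. [folklore] -/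
theorem regular_of_regCutoff_ne_zero {ρ : ℝ} (hρ : 0 < ρ)
    {M : (Fin (2 * L - 1 + 1) → Edge 3 L → Matrix (Fin 2) (Fin 2) ℂ) × (Site 3 L → Matrix (Fin 2) (Fin 2) ℂ)} (h : regCutoff ρ M ≠ 0) :
    (∃ k : Fin 3, ρ ^ 2 / 2 < linkMass k M) ∨ ρ ^ 2 / 2 < seamMass M := by
  by_contra hcon
  push Not at hcon
  exact h (regCutoff_eq_zero_of_central hρ hcon.1 hcon.2)

/-! ## §4 Smoothness and the frame-derivative letters of the patching -/

/-- The link masses are smooth functions of the coordinates. [folklore] -/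
theorem contDiff_linkMass (k : Fin 3) : ContDiff ℝ ∞ (linkMass (L := L) k) := by
  unfold linkMass
  exact contDiff_const.sub (((contDiff_reTr.comp (contDiff_coord_fst 0 (wrapEdge k))).div_const 2).pow 2)

/-- The seam mass is a smooth function of the coordinates. [folklore] -/
theorem contDiff_seamMass : ContDiff ℝ ∞ (seamMass (L := L)) := by
  unfold seamMass
  exact contDiff_const.sub (((contDiff_reTr.comp (contDiff_coord_snd 0)).div_const 2).pow 2)

/-- ★ **The regularity cut-off is a smooth function of the coordinates.** [folklore] -/
theorem contDiff_regCutoff (ρ : ℝ) : ContDiff ℝ ∞ (regCutoff (L := L) ρ) := by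
  unfold regCutoff
  have hψ : ∀ {f : ((Fin (2 * L - 1 + 1) → Edge 3 L → Matrix (Fin 2) (Fin 2) ℂ) × (Site 3 L → Matrix (Fin 2) (Fin 2) ℂ)) → ℝ},
      ContDiff ℝ ∞ f → ContDiff ℝ ∞ fun M => deficitStep (f M / ρ ^ 2) :=
    fun hf => contDiff_deficitStep.comp (hf.div_const _)
  exact contDiff_const.sub ((((hψ (contDiff_linkMass 0)).mul (hψ (contDiff_linkMass 1))).mul (hψ (contDiff_linkMass 2))).mul
    (hψ contDiff_seamMass))

/-- Product rule for frame derivatives of smooth functions of the coordinates. [folklore] -/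
theorem frameD_mul {f g : ((Fin (2 * L - 1 + 1) → Edge 3 L → Matrix (Fin 2) (Fin 2) ℂ) × (Site 3 L → Matrix (Fin 2) (Fin 2) ℂ)) → ℝ}
    (hf : ContDiff ℝ ∞ f) (hg : ContDiff ℝ ∞ g) (Y : ((Fin (2 * L - 1 + 1) × Edge 3 L) ⊕ Site 3 L) → Matrix (Fin 2) (Fin 2) ℂ)
    (M : (Fin (2 * L - 1 + 1) → Edge 3 L → Matrix (Fin 2) (Fin 2) ℂ) × (Site 3 L → Matrix (Fin 2) (Fin 2) ℂ)) :
    frameD Y (fun M' => f M' * g M') M = f M * frameD Y g M + g M * frameD Y f M := by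
  have hfg : (fun M' => f M' * g M') = f * g := rfl
  rw [frameD, frameD, frameD, hfg, fderiv_mul ((hf.differentiable (by simp)) M) ((hg.differentiable (by simp)) M)]
  rfl

/-- Frame derivative of `1 − f`. [folklore] -/
theorem frameD_one_sub (f : ((Fin (2 * L - 1 + 1) → Edge 3 L → Matrix (Fin 2) (Fin 2) ℂ) × (Site 3 L → Matrix (Fin 2) (Fin 2) ℂ)) → ℝ)
    (Y : ((Fin (2 * L - 1 + 1) × Edge 3 L) ⊕ Site 3 L) → Matrix (Fin 2) (Fin 2) ℂ)
    (M : (Fin (2 * L - 1 + 1) → Edge 3 L → Matrix (Fin 2) (Fin 2) ℂ) × (Site 3 L → Matrix (Fin 2) (Fin 2) ℂ)) :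
    frameD Y (fun M' => 1 - f M') M = -frameD Y f M := by
  rw [frameD, frameD, fderiv_const_sub]
  rfl

/-- ★ **Frame derivative of a patched coefficient**: for smooth `χ, c¹, c²`,
`∂_Y(χ·c¹ + (1 − χ)·c²) = χ·∂_Yc¹ + (1 − χ)·∂_Yc² + ∂_Yχ·(c¹ − c²)` — the patching identity whose last term is the unsigned cross term of the
divergence budget. [folklore] -/
theorem frameD_patch {χ c₁ c₂ : ((Fin (2 * L - 1 + 1) → Edge 3 L → Matrix (Fin 2) (Fin 2) ℂ) × (Site 3 L → Matrix (Fin 2) (Fin 2) ℂ)) → ℝ}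
    (hχ : ContDiff ℝ ∞ χ) (h₁ : ContDiff ℝ ∞ c₁) (h₂ : ContDiff ℝ ∞ c₂) (Y : ((Fin (2 * L - 1 + 1) × Edge 3 L) ⊕ Site 3 L) → Matrix (Fin 2) (Fin 2) ℂ)
    (M : (Fin (2 * L - 1 + 1) → Edge 3 L → Matrix (Fin 2) (Fin 2) ℂ) × (Site 3 L → Matrix (Fin 2) (Fin 2) ℂ)) :
    frameD Y (fun M' => χ M' * c₁ M' + (1 - χ M') * c₂ M') M =
      χ M * frameD Y c₁ M + (1 - χ M) * frameD Y c₂ M + frameD Y χ M * (c₁ M - c₂ M) := by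
  have hA : ContDiff ℝ ∞ fun M' => χ M' * c₁ M' := hχ.mul h₁
  have hB : ContDiff ℝ ∞ fun M' => (1 - χ M') * c₂ M' := (contDiff_const.sub hχ).mul h₂
  have hadd : frameD Y (fun M' => χ M' * c₁ M' + (1 - χ M') * c₂ M') M =
      frameD Y (fun M' => χ M' * c₁ M') M + frameD Y (fun M' => (1 - χ M') * c₂ M') M := by
    have hsum : (fun M' => χ M' * c₁ M' + (1 - χ M') * c₂ M') = (fun M' => χ M' * c₁ M') + fun M' => (1 - χ M') * c₂ M' := rfl
    rw [frameD, frameD, frameD, hsum, fderiv_add ((hA.differentiable (by simp)) M) ((hB.differentiable (by simp)) M)]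
    rfl
  rw [hadd, frameD_mul hχ h₁, frameD_mul (contDiff_const.sub hχ) h₂, frameD_one_sub χ]
  ring

/-- The patched coefficient of two smooth coefficients is smooth. [folklore] -/
theorem contDiff_patch {χ c₁ c₂ : ((Fin (2 * L - 1 + 1) → Edge 3 L → Matrix (Fin 2) (Fin 2) ℂ) × (Site 3 L → Matrix (Fin 2) (Fin 2) ℂ)) → ℝ}
    (hχ : ContDiff ℝ ∞ χ) (h₁ : ContDiff ℝ ∞ c₁) (h₂ : ContDiff ℝ ∞ c₂) :
    ContDiff ℝ ∞ fun M => χ M * c₁ M + (1 - χ M) * c₂ M :=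
  (hχ.mul h₁).add ((contDiff_const.sub hχ).mul h₂)

end Summit.QuantumFields.YangMills.Theorems.VirialFluxGap.RegCutoff

end
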